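import Literature.Probability.Percolation.InequalitiesProofs
import HarnessLib

/-!
# The antipodal form of the refined row R1 when the apex is adjacent to both terminals

Support file for `stmt-CriticalPhenomena-4575` (memo `prim-gen-kcluster/KCLUSTER-gen62.md`, §1;
conjecture ANTI₁ of `KCLUSTER-gen52.md` §3 / `KCLUSTER-gen54.md`).

Let `H` be a finite multigraph with vertex type `V` and edge labels `ι` (`ends : ι → Sym2 V`), and let
`x : ι → Bool` be a 2-colouring of its edges (`true` = open = colour `O`, `false` = closed = colour `K`).
Write `O_a`, `K_a` for the open and the closed cluster of the apex `a` (`AntipodalR1.clus`).  The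
*antipodal form of the refined row R1* (conjecture ANTI₁, the weight-free counting statement whose
graded version implies `t·s_a ≤ u_b·u_c` for every random-cluster measure `φ_{p,q}`, `q ≥ 1`) asserts
`#L ≤ #R(b,c)` for
* `L  = {x : b, c ∈ O_a ∖ K_a, K_a meets every b–c path of H}`   (`AntipodalR1.lSet`),
* `R(b,c) = {x : b ∈ O_a ∖ K_a, c ∈ K_a ∖ O_a}`                   (`AntipodalR1.rSet`).

**Theorem** (`AntipodalR1.card_lSet_le_card_rSet_of_adj`): if `a` is adjacent to `b` and to `c`
then `#L ≤ #R(b,c)` (every finite multigraph, no further hypothesis).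

Proof.  The events `{b ∈ O_a ∖ K_a}` and `{c ∈ O_a ∖ K_a}` are increasing in the set of open edges.  For
`x ∈ L` let `B` be the set of vertices joined to `b` by a path of `H` avoiding `K_a` (`AntipodalR1.region`)
and let `∂B` be the set of edges with one end in `B` and one end outside (`AntipodalR1.bdry`).  Every edge
of `∂B` is open and joins `B` to `K_a`; the edge `ab` lies in `∂B` and the edge `ac` does not (`c ∉ B` by
the separation).  Hence every colouring agreeing with `x` on `∂B` has `b ∈ O_a ∖ K_a`, and every colouring
agreeing with `x` off `∂B` has `c ∈ O_a ∖ K_a` (the region of `c` is sealed by edges that are open in `x`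
and lie off `∂B`).  So `L ⊆ {b ∈ O_a∖K_a} □ {c ∈ O_a∖K_a}` (disjoint occurrence with witness `∂B`), and
Reimer's flip lemma `|A □ B| ≤ |A ∩ B̄|` (`Literature.Probability.Percolation.reimer_flip_card_le`,
[cite: ReimerCPC2000, Thm. 1.2]) gives `#L ≤ #({b ∈ O_a∖K_a} ∩ flip{c ∈ O_a∖K_a}) = #R(b,c)`, because
the coordinatewise complement exchanges the open and the closed cluster.  [this work]
-/

namespace Summit.CriticalPhenomena.PercolationContinuityZ3.Theorems

namespace AntipodalR1

open Finset Relation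

variable {V ι : Type*}

/-- `nbr ends x col u`: the vertices joined to `u` by an edge of colour `col` (`true` = open) in the
colouring `x`. [this work] -/
def nbr (ends : ι → Sym2 V) (x : ι → Bool) (col : Bool) (u : V) : Set V :=
  {v | ∃ e, x e = col ∧ ends e = s(u, v)}

/-- `clus ends x col a`: the `col`-coloured cluster of `a` (`col = true`: the open cluster `O_a`;
`col = false`: the closed cluster `K_a`). [this work] -/
def clus (ends : ι → Sym2 V) (x : ι → Bool) (col : Bool) (a : V) : Set V :=
  {v | ReflTransGen (fun u w => w ∈ nbr ends x col u) a v}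

/-- `freeNbr ends x a u`: the support-graph neighbours `v` of `u` such that both `u` and `v` avoid the
closed cluster `K_a` (one step of a `b`–`c` path missed by `K_a`). [this work] -/
def freeNbr (ends : ι → Sym2 V) (x : ι → Bool) (a u : V) : Set V :=
  {v | (∃ e, ends e = s(u, v)) ∧ u ∉ clus ends x false a ∧ v ∉ clus ends x false a}

/-- `region ends x a b`: the vertices joined to `b` by a support path avoiding `K_a`; `K_a`
separates `b` from `c` iff `c ∉ region ends x a b`. [this work] -/
def region (ends : ι → Sym2 V) (x : ι → Bool) (a b : V) : Set V :=
  {v | ReflTransGen (fun u w => w ∈ freeNbr ends x a u) b v}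

variable [Fintype ι] [DecidableEq ι]

open Classical in
/-- `L = {x : b, c ∈ O_a ∖ K_a, K_a separates b from c}`, the left side of ANTI₁. [this work] -/
noncomputable def lSet (ends : ι → Sym2 V) (a b c : V) : Finset (ι → Bool) :=
  univ.filter fun x => b ∈ clus ends x true a ∧ b ∉ clus ends x false a ∧
    c ∈ clus ends x true a ∧ c ∉ clus ends x false a ∧ c ∉ region ends x a b

open Classical in
/-- `R(b,c) = {x : b ∈ O_a ∖ K_a, c ∈ K_a ∖ O_a}`, the right side of ANTI₁. [this work] -/
noncomputable def rSet (ends : ι → Sym2 V) (a b c : V) : Finset (ι → Bool) :=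
  univ.filter fun x => b ∈ clus ends x true a ∧ b ∉ clus ends x false a ∧
    c ∈ clus ends x false a ∧ c ∉ clus ends x true a

open Classical in
/-- The increasing event `{v ∈ O_a ∖ K_a}` as a finite set of colourings. [this work] -/
noncomputable def tSet (ends : ι → Sym2 V) (a v : V) : Finset (ι → Bool) :=
  univ.filter fun x => v ∈ clus ends x true a ∧ v ∉ clus ends x false a

open Classical in
/-- `∂B(x)`: the edges with one end in the region `B = region ends x a b` of `b` and one end outside
it. [this work] -/
noncomputable def bdry (ends : ι → Sym2 V) (x : ι → Bool) (a b : V) : Finset ι :=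
  univ.filter fun e => ∃ u v, ends e = s(u, v) ∧ u ∈ region ends x a b ∧ v ∉ region ends x a b

omit [Fintype ι] [DecidableEq ι] in
/-- Unfolding membership in a cluster. [this work] -/
theorem mem_clus {ends : ι → Sym2 V} {x : ι → Bool} {col : Bool} {a v : V} :
    v ∈ clus ends x col a ↔ ReflTransGen (fun u w => w ∈ nbr ends x col u) a v := Iff.rfl

omit [Fintype ι] [DecidableEq ι] in
/-- Unfolding membership in a region. [this work] -/
theorem mem_region {ends : ι → Sym2 V} {x : ι → Bool} {a b v : V} :
    v ∈ region ends x a b ↔ ReflTransGen (fun u w => w ∈ freeNbr ends x a u) b v := Iff.rfl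

omit [Fintype ι] [DecidableEq ι] in
/-- Coloured adjacency is symmetric. [this work] -/
theorem nbr_symm {ends : ι → Sym2 V} {x : ι → Bool} {col : Bool} {u v : V}
    (h : v ∈ nbr ends x col u) : u ∈ nbr ends x col v := by
  obtain ⟨e, he, hends⟩ := h
  exact ⟨e, he, by rw [hends, Sym2.eq_swap]⟩

omit [Fintype ι] [DecidableEq ι] in
/-- `freeNbr` is symmetric. [this work] -/
theorem freeNbr_symm {ends : ι → Sym2 V} {x : ι → Bool} {a u v : V}
    (h : v ∈ freeNbr ends x a u) : u ∈ freeNbr ends x a v := by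
  obtain ⟨⟨e, he⟩, hu, hv⟩ := h
  exact ⟨⟨e, by rw [he, Sym2.eq_swap]⟩, hv, hu⟩

omit [Fintype ι] [DecidableEq ι] in
/-- Paths avoiding `K_a` can be reversed. [this work] -/
theorem region_symm {ends : ι → Sym2 V} {x : ι → Bool} {a u v : V}
    (h : ReflTransGen (fun u w => w ∈ freeNbr ends x a u) u v) :
    ReflTransGen (fun u w => w ∈ freeNbr ends x a u) v u := by
  induction h with
  | refl => exact ReflTransGen.refl
  | tail _ hbc ih => exact ReflTransGen.head (freeNbr_symm hbc) ih

omit [Fintype ι] [DecidableEq ι] in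
/-- A cluster is closed under one more step. [this work] -/
theorem clus_step {ends : ι → Sym2 V} {x : ι → Bool} {col : Bool} {a u v : V}
    (hu : u ∈ clus ends x col a) (huv : v ∈ nbr ends x col u) : v ∈ clus ends x col a :=
  ReflTransGen.tail hu huv

omit [Fintype ι] [DecidableEq ι] in
/-- Flipping every edge exchanges the two coloured adjacencies. [this work] -/
theorem nbr_flip (ends : ι → Sym2 V) (x : ι → Bool) (col : Bool) :
    nbr ends (fun i => !x i) col = nbr ends x (!col) := by
  funext u
  ext v
  constructor
  · rintro ⟨e, he, hends⟩
    refine ⟨e, ?_, hends⟩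
    cases hx : x e <;> cases col <;> simp_all
  · rintro ⟨e, he, hends⟩
    refine ⟨e, ?_, hends⟩
    cases hx : x e <;> cases col <;> simp_all

omit [Fintype ι] [DecidableEq ι] in
/-- Flipping every edge exchanges the open and the closed cluster. [this work] -/
theorem mem_clus_flip (ends : ι → Sym2 V) (x : ι → Bool) (col : Bool) (a v : V) :
    v ∈ clus ends (fun i => !x i) col a ↔ v ∈ clus ends x (!col) a := by
  rw [mem_clus, mem_clus, nbr_flip]

omit [Fintype ι] [DecidableEq ι] in
/-- Vertices of the region of `b` avoid `K_a` (given `b ∉ K_a`). [this work] -/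
theorem not_mem_clus_of_region {ends : ι → Sym2 V} {x : ι → Bool} {a b v : V}
    (hb : b ∉ clus ends x false a) (hv : ReflTransGen (fun u w => w ∈ freeNbr ends x a u) b v) :
    v ∉ clus ends x false a := by
  induction hv with
  | refl => exact hb
  | tail _ huv _ => exact huv.2.2

omit [DecidableEq ι] in
/-- Every edge of `∂B` is open. [this work] -/
theorem bdry_open {ends : ι → Sym2 V} {x : ι → Bool} {a b : V}
    (hb : b ∉ clus ends x false a) {e : ι} (he : e ∈ bdry ends x a b) : x e = true := by
  classical
  obtain ⟨u, v, hends, hu, hv⟩ := (Finset.mem_filter.1 he).2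
  rw [mem_region] at hu hv
  cases hxe : x e
  · exfalso
    have huv : v ∈ nbr ends x false u := ⟨e, hxe, hends⟩
    have hu' : u ∉ clus ends x false a := not_mem_clus_of_region hb hu
    have hv' : v ∉ clus ends x false a := fun h => hu' (clus_step h (nbr_symm huv))
    exact hv (ReflTransGen.tail hu ⟨⟨e, hends⟩, hu', hv'⟩)
  · rfl

omit [DecidableEq ι] in
/-- An edge from the region `B` to a vertex outside it lies in `∂B`. [this work] -/
theorem mem_bdry {ends : ι → Sym2 V} {x : ι → Bool} {a b u v : V} {e : ι}
    (hends : ends e = s(u, v)) (hu : ReflTransGen (fun u w => w ∈ freeNbr ends x a u) b u)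
    (hv : ¬ ReflTransGen (fun u w => w ∈ freeNbr ends x a u) b v) : e ∈ bdry ends x a b := by
  classical
  exact Finset.mem_filter.2 ⟨Finset.mem_univ _, u, v, hends, hu, hv⟩

/-- **Key inclusion.**  If `a ~ b` and `a ~ c`, every `x ∈ L` lies in the disjoint occurrence
`{b ∈ O_a∖K_a} □ {c ∈ O_a∖K_a}`, witnessed by `K = ∂B(x)`. [this work] -/
theorem lSet_subset_box (ends : ι → Sym2 V) {a b c : V}
    (hab : ∃ e, ends e = s(a, b)) (hac : ∃ e, ends e = s(a, c)) :
    lSet ends a b c ⊆ univ.filter fun x : ι → Bool => ∃ K : Finset ι,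
      (∀ z : ι → Bool, (∀ i ∈ K, z i = x i) → z ∈ tSet ends a b) ∧
      (∀ z : ι → Bool, (∀ i, i ∉ K → z i = x i) → z ∈ tSet ends a c) := by
  classical
  intro x hx
  obtain ⟨hOb, hKb, hOc, hKc, hsep⟩ := (Finset.mem_filter.1 hx).2
  rw [mem_region] at hsep
  obtain ⟨eab, heab⟩ := hab
  obtain ⟨eac, heac⟩ := hac
  have haB : ¬ ReflTransGen (fun u w => w ∈ freeNbr ends x a u) b a :=
    fun h => not_mem_clus_of_region hKb h ReflTransGen.refl
  refine Finset.mem_filter.2 ⟨Finset.mem_univ _, bdry ends x a b, ?_, ?_⟩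
  · -- agreeing with `x` on `∂B` forces `b ∈ O_a ∖ K_a`
    intro z hz
    have heabK : eab ∈ bdry ends x a b :=
      mem_bdry (by rw [heab, Sym2.eq_swap]) ReflTransGen.refl haB
    have hzab : z eab = true := by rw [hz eab heabK]; exact bdry_open hKb heabK
    refine Finset.mem_filter.2 ⟨Finset.mem_univ _, ReflTransGen.single ⟨eab, hzab, heab⟩, ?_⟩
    -- the complement of `B` is closed under closed adjacency in `z`
    have key : ∀ v, ReflTransGen (fun u w => w ∈ nbr ends z false u) a v →
        ¬ ReflTransGen (fun u w => w ∈ freeNbr ends x a u) b v := by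
      intro v hv
      induction hv with
      | refl => exact haB
      | tail _ huv ih =>
        intro hvB
        obtain ⟨e, hze, hends⟩ := huv
        have heK : e ∈ bdry ends x a b := mem_bdry (by rw [hends, Sym2.eq_swap]) hvB ih
        have : z e = true := by rw [hz e heK]; exact bdry_open hKb heK
        rw [hze] at this
        exact Bool.false_ne_true this
    exact fun h => key b h ReflTransGen.refl
  · -- agreeing with `x` off `∂B` forces `c ∈ O_a ∖ K_a`
    intro z hz
    -- the edge `ac` is not in `∂B` and is open
    have heacK : eac ∉ bdry ends x a b := by
      intro h
      obtain ⟨u, v, hends, hu, hv⟩ := (Finset.mem_filter.1 h).2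
      rw [mem_region] at hu hv
      rw [heac, Sym2.eq_iff] at hends
      rcases hends with ⟨rfl, rfl⟩ | ⟨rfl, rfl⟩
      · exact haB hu
      · exact hsep hu
    have hxac : x eac = true := by
      cases h : x eac
      · exact absurd (ReflTransGen.single ⟨eac, h, heac⟩) hKc
      · rfl
    have hzac : z eac = true := by rw [hz eac heacK]; exact hxac
    refine Finset.mem_filter.2 ⟨Finset.mem_univ _, ReflTransGen.single ⟨eac, hzac, heac⟩, ?_⟩
    -- the region `X` of `c` (w.r.t. `K_a(x)`) is closed under closed adjacency in `z`
    have key : ∀ v, ReflTransGen (fun u w => w ∈ nbr ends z false u) a v →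
        ¬ ReflTransGen (fun u w => w ∈ freeNbr ends x a u) c v := by
      intro v hv
      induction hv with
      | refl => exact fun h => not_mem_clus_of_region hKc h ReflTransGen.refl
      | @tail u w _ huv ih =>
        intro hwX
        obtain ⟨e, hze, hends⟩ := huv
        -- `e ∉ ∂B`
        have heK : e ∉ bdry ends x a b := by
          intro heK
          obtain ⟨u', v', hends', hu', hv'⟩ := (Finset.mem_filter.1 heK).2
          rw [mem_region] at hu' hv'
          rw [hends, Sym2.eq_iff] at hends'
          rcases hends' with ⟨rfl, rfl⟩ | ⟨rfl, rfl⟩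
          · -- `u ∈ B`, `w ∈ X`: then `w ∈ B` through the edge `e`
            have hwK : w ∉ clus ends x false a := not_mem_clus_of_region hKc hwX
            have huK : u ∉ clus ends x false a := not_mem_clus_of_region hKb hu'
            exact hv' (ReflTransGen.tail hu' ⟨⟨e, hends⟩, huK, hwK⟩)
          · -- `w ∈ B ∩ X`: then `b` and `c` are joined avoiding `K_a`
            exact hsep (ReflTransGen.trans hu' (region_symm hwX))
        have hxe : x e = false := by rw [← hz e heK]; exact hze
        have hwK : w ∉ clus ends x false a := not_mem_clus_of_region hKc hwX
        have huK : u ∉ clus ends x false a :=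
          fun h => hwK (clus_step h ⟨e, hxe, hends⟩)
        exact ih (ReflTransGen.tail hwX ⟨⟨e, by rw [hends, Sym2.eq_swap]⟩, hwK, huK⟩)
    exact fun h => key c h ReflTransGen.refl

/-- The flip of `{c ∈ O_a∖K_a}` met with `{b ∈ O_a∖K_a}` is contained in `R(b,c)`. [this work] -/
theorem tSet_inter_image_subset (ends : ι → Sym2 V) (a b c : V) :
    tSet ends a b ∩ (tSet ends a c).image (fun x i => !x i) ⊆ rSet ends a b c := by
  classical
  intro z hz
  obtain ⟨hzb, hzc⟩ := Finset.mem_inter.1 hz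
  obtain ⟨hOb, hKb⟩ := (Finset.mem_filter.1 hzb).2
  obtain ⟨y, hy, rfl⟩ := Finset.mem_image.1 hzc
  obtain ⟨hOc, hKc⟩ := (Finset.mem_filter.1 hy).2
  refine Finset.mem_filter.2 ⟨Finset.mem_univ _, hOb, hKb, ?_, ?_⟩
  · exact (mem_clus_flip ends y false a c).2 hOc
  · exact fun h => hKc ((mem_clus_flip ends y true a c).1 h)

/-- **Theorem** (antipodal refined row R1, apex adjacent to both terminals).  For every finite
multigraph (`ends : ι → Sym2 V`) and vertices `a, b, c` with `a ~ b` and `a ~ c`: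
`#{x : b, c ∈ O_a∖K_a, K_a separates b | c} ≤ #{x : b ∈ O_a∖K_a, c ∈ K_a∖O_a}`, i.e. conjecture
ANTI₁ of `KCLUSTER-gen52` §3 holds (ungraded, `q = 1`) whenever the apex is adjacent to both
terminals.  Proof: `lSet_subset_box`, Reimer's flip lemma
`Literature.Probability.Percolation.reimer_flip_card_le` [cite: ReimerCPC2000, Thm. 1.2], and
`tSet_inter_image_subset`. [this work] -/
theorem card_lSet_le_card_rSet_of_adj (ends : ι → Sym2 V) {a b c : V}
    (hab : ∃ e, ends e = s(a, b)) (hac : ∃ e, ends e = s(a, c)) :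
    (lSet ends a b c).card ≤ (rSet ends a b c).card :=
  calc (lSet ends a b c).card
      ≤ (univ.filter fun x : ι → Bool => ∃ K : Finset ι,
          (∀ z : ι → Bool, (∀ i ∈ K, z i = x i) → z ∈ tSet ends a b) ∧
          (∀ z : ι → Bool, (∀ i, i ∉ K → z i = x i) → z ∈ tSet ends a c)).card :=
        Finset.card_le_card (lSet_subset_box ends hab hac)
    _ ≤ (tSet ends a b ∩ (tSet ends a c).image fun x i => !x i).card :=
        Literature.Probability.Percolation.reimer_flip_card_le _ _
    _ ≤ (rSet ends a b c).card := Finset.card_le_card (tSet_inter_image_subset ends a b c)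

end AntipodalR1

end Summit.CriticalPhenomena.PercolationContinuityZ3.Theorems
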